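import Summits.ResolutionOfSingularities.ResolutionOfSingularities.Theorems.PurelyInseparableDim4Target
import Summits.ResolutionOfSingularities.ResolutionOfSingularities.Theorems.PurelyInseparableDim4Rules
import Summits.ResolutionOfSingularities.ResolutionOfSingularities.Theorems.PurelyInseparableDim4Scope
import HarnessLib
import HarnessLib.Audit.Tags

/-!
# Purely inseparable dim-4 census — the SPINE GAME (cell res-dim4-pi WORD #22; TY-9)

Defs-only.  On spine edges (`b = 0`) of the coordinate-centre walk the exponent map
`CentreBlowup.chartExponent q S j` is injective on the support and coefficients are carried verbatim,
so the walk read on SUPPORTS is a purely combinatorial game: Hironaka's constrained polyhedra game in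
four variables (permissible `J`: `Σ_{j∈J} a_j ≥ q` on the support; move `a_j ↦ Σ_{i∈J} a_i − q`;
player B picks the chart `j ∈ J`; player A has won when some point has total degree `< q`), with ONE
extra rule coming from cleaning: points all of whose coordinates are divisible by `q` are deleted
after each move.  [cite: Spivakovsky1983] [cite: Hauser2003, §1 (the polyhedra game)]

The cell's LEMMA D1 (elementary): deletions happen at most `#A₀ − 1` times along a play, so a
positional strategy winning the pure game from every position also wins the game with deletions;
Spivakovsky's theorem (a winning strategy of the pure constrained game) is recorded here only as a
NAMED HYPOTHESIS `PurePositionalWin4 q`, never asserted.  Prover bricks (not in this file):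
`PurePositionalWin4 q → PositionalWin4 q` (D1) and `PositionalWin4 q → SpineTerminatesSomeRule p q`
(the support dictionary).  Nothing here is a theorem about resolution in dimension ≥ 4.
-/

set_option linter.dupNamespace false -- mandated namespace of this single-conjunct summit

namespace Summit.ResolutionOfSingularities.ResolutionOfSingularities.Theorems.PIDim4

open Finset
open Literature.AlgebraicGeometry.Resolution

/-! ## 1. Positions, permissibility, moves -/

/-- A position of the spine game: a finite set of exponent vectors (the support of `F`). [folklore] -/
abbrev SpinePos : Type := Finset (Fin 4 →₀ ℕ)

/-- **Permissible** `J` at the position `A`: `J ≠ ∅` and `q ≤ Σ_{j∈J} a_j` for every `a ∈ A`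
(= `IsPermissibleCentre` read on the support). [cite: Spivakovsky1983, §1 (permissible sets)] -/
def SpinePermissible (q : ℕ) (J : Finset (Fin 4)) (A : SpinePos) : Prop :=
  J.Nonempty ∧ ∀ a ∈ A, q ≤ CentreBlowup.degIn J a

/-- The PURE move (Hironaka's game): chart `j` of the blow-up of `J`, `a ↦ chartExponent q J j a`.
[cite: Spivakovsky1983, §1] -/
noncomputable def pureMove (q : ℕ) (J : Finset (Fin 4)) (j : Fin 4) (A : SpinePos) : SpinePos :=
  A.image (CentreBlowup.chartExponent q J j)

/-- The SPINE move: the pure move followed by the cleaning deletion of the `q`-divisible points.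
[cite: Hauser2010, §G (cleaning)] [folklore] -/
noncomputable def spineMove (q : ℕ) (J : Finset (Fin 4)) (j : Fin 4) (A : SpinePos) : SpinePos :=
  (pureMove q J j A).filter fun a => ¬ ∀ i, q ∣ a i

/-- Player A has WON at `A` (the walk stops): the position is empty or some point has total degree
`< q` (the origin is no longer `q`-fold). [cite: Spivakovsky1983, §1 (end of the game)] -/
def SpineWon (q : ℕ) (A : SpinePos) : Prop := A = ∅ ∨ ∃ a ∈ A, a.degree < q

/-- A positional strategy of player A. [folklore] -/
abbrev SpineStrategy : Type := SpinePos → Finset (Fin 4)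

/-! ## 2. Plays and positional wins -/

/-- An infinite PURE play following `σ` (player B picks `j ∈ σ Aₖ` while A has not won). [folklore] -/
def IsPurePlay (q : ℕ) (σ : SpineStrategy) (A : ℕ → SpinePos) : Prop :=
  ∀ k, ¬ SpineWon q (A k) ∧ ∃ j ∈ σ (A k), A (k + 1) = pureMove q (σ (A k)) j (A k)

/-- An infinite SPINE play following `σ` (with deletions). [folklore] -/
def IsSpinePlay (q : ℕ) (σ : SpineStrategy) (A : ℕ → SpinePos) : Prop :=
  ∀ k, ¬ SpineWon q (A k) ∧ ∃ j ∈ σ (A k), A (k + 1) = spineMove q (σ (A k)) j (A k)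

/-- `σ` wins the PURE game from every position: permissible whenever A has not yet won, and no
infinite pure play. [folklore] -/
def IsPurePositionalWin (q : ℕ) (σ : SpineStrategy) : Prop :=
  (∀ A, ¬ SpineWon q A → SpinePermissible q (σ A) A) ∧ ¬ ∃ A : ℕ → SpinePos, IsPurePlay q σ A

/-- `σ` wins the SPINE game (with deletions) from every position. [folklore] -/
def IsSpinePositionalWin (q : ℕ) (σ : SpineStrategy) : Prop :=
  (∀ A, ¬ SpineWon q A → SpinePermissible q (σ A) A) ∧ ¬ ∃ A : ℕ → SpinePos, IsSpinePlay q σ A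

/-- **NAMED HYPOTHESIS (Spivakovsky 1983, positional form)**: Hironaka's constrained polyhedra game in
four variables has a positional winning strategy for player A.  Used only as a hypothesis `(h : …)`;
the positional reading follows Bogner–Weinzierl's transcription. [cite: Spivakovsky1983, Thm (winning strategy)] -/
def PurePositionalWin4 (q : ℕ) : Prop := ∃ σ : SpineStrategy, IsPurePositionalWin q σ

/-- **F4-S read on supports**: the spine game with deletions has a positional winning strategy. [folklore] -/
def PositionalWin4 (q : ℕ) : Prop := ∃ σ : SpineStrategy, IsSpinePositionalWin q σ

/-! ## 3. The cheap facts -/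

/-- A deletion-free spine move is the pure move. [folklore] -/
theorem spineMove_subset_pureMove (q : ℕ) (J : Finset (Fin 4)) (j : Fin 4) (A : SpinePos) :
    spineMove q J j A ⊆ pureMove q J j A :=
  Finset.filter_subset _ _

/-- The support never grows along a spine move (LEMMA D1, counting half). [folklore] -/
theorem card_spineMove_le (q : ℕ) (J : Finset (Fin 4)) (j : Fin 4) (A : SpinePos) :
    (spineMove q J j A).card ≤ A.card :=
  (Finset.card_le_card (spineMove_subset_pureMove q J j A)).trans Finset.card_image_le

/-- Permissibility on the support is permissibility of the coordinate centre. [folklore] -/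
theorem spinePermissible_support_iff {K : Type} [Field K] (q : ℕ) (J : Finset (Fin 4))
    (F : MvPolynomial (Fin 4) K) :
    SpinePermissible q J F.support ↔ IsPermissibleCentre q J F := by
  unfold SpinePermissible IsPermissibleCentre CentreBlowup.ordAlong
  constructor
  · rintro ⟨hJ, h⟩
    refine ⟨hJ, ?_⟩
    refine Finset.le_inf fun d hd => ?_
    exact_mod_cast h d hd
  · rintro ⟨hJ, h⟩
    refine ⟨hJ, fun a ha => ?_⟩
    have := (Finset.le_inf_iff.mp h) a ha
    exact_mod_cast this

end Summit.ResolutionOfSingularities.ResolutionOfSingularities.Theorems.PIDim4
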